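import Literature.NumberTheory.EllipticCurves.MultiplicativeTransvectionPrimeToVProofs
import Literature.NumberTheory.EllipticCurves.MultiplicativeRamifiedTorsionPowProofs
import Literature.NumberTheory.EllipticCurves.TateModuleWildKernelProofs
import Literature.NumberTheory.EllipticCurves.TateModuleFinrankProofs
import Literature.NumberTheory.EllipticCurves.TateModuleFreeProofs
import Literature.NumberTheory.EllipticCurves.KodairaNeronUnramifiedInertiaProofs
import Literature.NumberTheory.GaloisRepresentations.DecompositionGroupOfCompletion
import Literature.NumberTheory.EllipticCurves.GreenbergSelmer
import Literature.NumberTheory.EllipticCurves.GeomPointsGaloisModule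
import Literature.NumberTheory.EllipticCurves.LocalTorsionMultiplicativeProofs
import Literature.NumberTheory.EllipticCurves.SemistableModPImageIrreducibleProofs
import Summits.BirchSwinnertonDyer.BirchSwinnertonDyer.Theorems.OneSidedTwistSqueezeX9KatoDivisibilityX9ULedgerFinTwoKernels

set_option autoImplicit false

-- the summit and its single problem are both named `BirchSwinnertonDyer` (registry layout D-0017)
set_option linter.dupNamespace false

/-!
# The `E`-level tame monodromy digits at a multiplicative prime are tree facts
# (helpers for crux stmt-BirchSwinnertonDyer-20547 `KatoDivisibilityX9`, line `prime_adapted_tau`, stub 3 (U))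

Port (verbatim, re-homed) of §H (`E`-side) and §I (`E`-side) of the bsd-f3-mu cell's kernel-checked sketch
`Sketch71.lean` v5 f376123484d02b28 (planner-bsd-f3-mu-desc g71; standalone check `H71.lean` 0f780ad58326cf78 for §H;
port plan PORT-PLAN-72 file P4a, desc g72).  Namespace `WeierstrassCurve` (dot notation on `W : WeierstrassCurve K`,
`K` a number field, `v` a finite place, `I_v = GreenbergSelmer.inertia v`):

* §H `exists_inertia_smul_ne_of_hasMultiplicativeReductionAt_of_not_pow_dvd`,
  `exists_absInertia_unipotent_smul_ne_of_not_pow_dvd` — at a multiplicative `v ∤ p` with `p^k ∤ ord_v(Δ_min)` the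
  inertia group moves a `p^k`-torsion point (the `p^k` generalisation of the tree's `k = 1`
  `exists_inertia_smul_ne_of_hasMultiplicativeReductionAt_of_not_dvd`, via `exists_inertia_map_ne_pow_of_multiplicative`,
  Silverman *ATAEC* Ex. 5.13(b)) and acts unipotently; lifted to the Tate module:
  `galoisRepTate_sub_one_mul_self_eq_zero`, `det_trace_galoisRepTate_of_unipotent`, `galoisRepTate_sub_one_ne_pow_smul`,
  `exists_inertia_tateDigits_of_not_pow_dvd` — some `τ ∈ I_v` has `(ρ(τ) − 1)² = 0`, `det ρ(τ) = 1`, `tr ρ(τ) = 2`,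
  `ρ(τ) − 1 ∉ p^k End(T_p E)` (for `k = 2` exactly the `W`-digits of `TameMonodromyDigitsAt`);
* §I `dvd_ordMinimalDiscriminant_of_not_hasSurjectiveModNGaloisRep` (over `ℚ`) — `E[p]` irreducible, `ρ̄_{E,p}` not
  onto, `v ∤ p` multiplicative ⟹ `p ∣ ord_v(Δ_min)` (`m_v ≥ 1` from the image type; Serre 1972 Prop. 15 via the tree's
  `not_dvd_card_of_not_hasSurjectiveModNGaloisRep`).

Not re-landed: the sketch's twin `one_le_ordMinimalDiscriminant_of_hasMultiplicativeReductionAt'` of the tree's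
`ordMinimalDiscriminant_pos_of_hasMultiplicativeReductionAt` (the consumer `…ULedger.lean` cites the tree lemma).
No ledger item is closed here; BSD is proved for no curve.  References: [SilvermanATAEC1994] Cor. IV.9.2 (d), V.4–V.5,
Ex. 5.13 (b); [SerreAbelianLadic1968] Ch. IV A.1.2; [Serre1972] §2.4 Prop. 15, §5.4; [SilvermanAEC2009] Prop. VII.5.1(b).
-/

noncomputable section

open scoped Classical NumberField NNReal

universe u

namespace WeierstrassCurve

open NumberField IsDedekindDomain
open Literature.NumberTheory.EllipticCurves Literature.NumberTheory.GaloisRepresentations Field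
  IsDedekindDomain.HeightOneSpectrum

variable {K : Type u} [Field K] [NumberField K] {v : HeightOneSpectrum (𝓞 K)}
  (W : WeierstrassCurve K)

/-- **`p^k ∤ ord_v(Δ_min)` ⟹ the inertia group at a multiplicative `v ∤ p` moves a `p^k`-torsion point of
`E(K̄_v)`** (the tree's `exists_inertia_smul_ne_of_hasMultiplicativeReductionAt_of_not_dvd` with
`exists_inertia_map_ne_pow_of_multiplicative` in place of its `k = 1` input; packaging copied verbatim).
[cite: SilvermanATAEC1994, Cor. IV.9.2 (d) and Exercise 5.13 (b) (PDF p. 416)]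
[cite: SerreAbelianLadic1968, Ch. IV, A.1.2] -/
theorem exists_inertia_smul_ne_of_hasMultiplicativeReductionAt_of_not_pow_dvd [W.IsElliptic]
    (hmult : W.HasMultiplicativeReductionAt v) {p : ℕ} (hp : p.Prime)
    (hpv : (p : 𝓞 K) ∉ v.asIdeal) {k : ℕ} (hk : 1 ≤ k)
    (hndvd : ¬ p ^ k ∣ W.ordMinimalDiscriminant v)
    {w : Valuation (AlgebraicClosure (v.adicCompletion K)) ℝ≥0}
    (hw : ∀ x, (w x : ℝ) =
      spectralNorm (v.adicCompletion K) (AlgebraicClosure (v.adicCompletion K)) x)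
    {𝔐 : Ideal v.localAbsIntegers} (h𝔐 : 𝔐 ∈ v.localPrimesAbove) :
    ∃ σ ∈ 𝔐.inertia (absoluteGaloisGroup (v.adicCompletion K)),
      ∃ Q : localPoints W (v.adicCompletion K), p ^ k • Q = 0 ∧ σ • Q ≠ Q := by
  -- the integral minimal model `X₀` at `v`
  set X := W.localMinimalModel v with hXdef
  haveI : X.IsElliptic := W.isElliptic_localMinimalModel v
  have hmult' : X.HasMultiplicativeReduction (v.adicCompletionIntegers K) := hmult
  set X₀ : WeierstrassCurve (v.adicCompletionIntegers K) :=
    X.integralModel (v.adicCompletionIntegers K) with hX₀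
  have hX₀X : X₀.baseChange (v.adicCompletion K) = X :=
    baseChange_integralModel_eq (v.adicCompletionIntegers K) X
  -- `Δ(X₀) ∈ 𝔪_v`, `c₄(X₀) ∈ 𝓞_v^×`
  have hΔm : X₀.Δ ∈ IsLocalRing.maximalIdeal (v.adicCompletionIntegers K) := by
    have h := hmult'.badReduction
    rw [← integralModel_Δ_eq (v.adicCompletionIntegers K) X] at h
    exact (valuation_lt_one_iff_mem _ _).mp h
  have hc₄ : X₀.c₄ ∉ IsLocalRing.maximalIdeal (v.adicCompletionIntegers K) := by
    have h := hmult'.multiplicativeReduction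
    rw [← integralModel_c₄_eq (v.adicCompletionIntegers K) X, valuation_of_algebraMap] at h
    exact intValuation_eq_one_iff.mp h
  -- `Δ(X₀) = α π^m`, `m = ord_v(Δ_min) ≥ 1`
  obtain ⟨π, hπ⟩ := IsDiscreteValuationRing.exists_irreducible (v.adicCompletionIntegers K)
  have hΔ0 : X₀.Δ ≠ 0 := by
    intro h0
    apply X.isUnit_Δ.ne_zero
    rw [← hX₀X]
    change (X₀.map _).Δ = 0
    rw [map_Δ, h0, map_zero]
  obtain ⟨m, α, hα⟩ := IsDiscreteValuationRing.eq_unit_mul_pow_irreducible hΔ0 hπ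
  have hm : W.ordMinimalDiscriminant v = m := by
    change (IsDiscreteValuationRing.addVal (v.adicCompletionIntegers K) X₀.Δ).toNat = m
    rw [IsDiscreteValuationRing.addVal_def X₀.Δ α hπ m hα]
    rfl
  have hm1 : 1 ≤ m := by
    rcases Nat.eq_zero_or_pos m with h0 | hpos
    · exfalso
      rw [h0, pow_zero, mul_one] at hα
      rw [hα] at hΔm
      exact (IsLocalRing.mem_maximalIdeal _).mp hΔm α.isUnit
    · exact hpos
  rw [hm] at hndvd
  -- the local theorem on `X₀(K̄_v)` and transport `E(K̄_v) ≃ X₀(K̄_v)`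
  obtain ⟨σ, hσ, P, hpP, hσP⟩ :=
    exists_inertia_map_ne_pow_of_multiplicative hw X₀ α.isUnit hπ hm1 hα hc₄ hp hpv hk hndvd h𝔐
  obtain ⟨C, hC⟩ := W.exists_variableChange_smul_eq_localMinimalModel v
  have hC' : C • W.baseChange (v.adicCompletion K) = X₀.baseChange (v.adicCompletion K) := by
    rw [hC, hX₀X]
  obtain ⟨Φ, hΦ⟩ := W.exists_addEquiv_localPoints_of_smul_eq v hC'
  refine ⟨σ, hσ, Φ.symm P, ?_, fun h ↦ hσP ?_⟩
  · apply Φ.injective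
    rw [map_nsmul, AddEquiv.apply_symm_apply, hpP, map_zero]
  · have := hΦ σ (Φ.symm P)
    rw [h, AddEquiv.apply_symm_apply] at this
    exact this.symm

/-- **Global form.** At a multiplicative `v ∤ p` with `p^k ∤ ord_v(Δ_min)` (`k ≥ 1`) there is `τ` in the local
inertia group `I_{K_v}` whose restriction `σ = res τ ∈ Γ_K` acts unipotently on EVERY `E[p^n]`
(`σ (σ P - P) = σ P - P`) and moves some `Q ∈ E[p^k]`.
[cite: SilvermanATAEC1994, V.4–V.5 (Tate curve) and Exercise 5.13(b) (PDF p. 416)] [cite: SerreAbelianLadic1968, Ch. IV, A.1.2] -/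
theorem exists_absInertia_unipotent_smul_ne_of_not_pow_dvd [W.IsElliptic]
    (hmult : W.HasMultiplicativeReductionAt v) {p : ℕ} (hp : p.Prime)
    (hpv : (p : 𝓞 K) ∉ v.asIdeal) {k : ℕ} (hk : 1 ≤ k)
    (hndvd : ¬ p ^ k ∣ W.ordMinimalDiscriminant v) :
    ∃ τ ∈ absInertia (v.adicCompletion K),
      (∀ (n : ℕ) (P : geomTorsion W ((p ^ n : ℕ) : ℤ)),
          resGal (K := K) (v.adicCompletion K) τ • (resGal (K := K) (v.adicCompletion K) τ • P - P) =
            resGal (K := K) (v.adicCompletion K) τ • P - P) ∧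
        ∃ Q : geomTorsion W ((p ^ k : ℕ) : ℤ), resGal (K := K) (v.adicCompletion K) τ • Q ≠ Q := by
  obtain ⟨w, hw⟩ := v.exists_spectralValuation
  obtain ⟨𝔐, h𝔐⟩ := v.localPrimesAbove_nonempty
  obtain ⟨τ, hτ, Q, hpQ, hτQ⟩ :=
    W.exists_inertia_smul_ne_of_hasMultiplicativeReductionAt_of_not_pow_dvd hmult hp hpv hk hndvd hw h𝔐
  have hτabs : τ ∈ absInertia (v.adicCompletion K) := by
    rw [← inertia_eq_absInertia hw h𝔐]; exact hτ
  have hinj : Function.Injective (pointsMap W (v.adicCompletion K)) :=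
    pointsMapOfEmb_injective W _
  refine ⟨τ, hτabs, fun n P ↦ ?_, ?_⟩
  · -- `(σ - 1)² = 0` on `E[p^n]`, read in `E(K̄_v)`
    rcases Nat.eq_zero_or_pos n with hn0 | hn
    · -- `E[p^0] = 0`
      have hP0 : (P : geomPoints W) = 0 := by
        have h2 : ((p ^ n : ℕ) : ℤ) • (P : geomPoints W) = 0 :=
          (Submodule.mem_torsionBy_iff _ _).mp P.2
        simpa [hn0] using h2
      apply Subtype.ext
      simp only [AddSubgroupClass.coe_sub,
        Literature.NumberTheory.EllipticCurves.AddSubgroup.torsionBy.coe_smul, hP0, smul_zero,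
        sub_zero]
    have hP' : p ^ n • pointsMap W (v.adicCompletion K) (P : geomPoints W) = 0 := by
      rw [← map_nsmul, ← natCast_zsmul]
      have h2 : ((p ^ n : ℕ) : ℤ) • (P : geomPoints W) = 0 :=
        (Submodule.mem_torsionBy_iff _ _).mp P.2
      rw [h2, map_zero]
    have key := W.smul_smul_sub_eq_of_mem_inertia_of_hasMultiplicativeReductionAt hmult hp hpv hn
      hw h𝔐 hτ (pointsMap W (v.adicCompletion K) (P : geomPoints W)) hP'
    apply Subtype.ext
    simp only [AddSubgroupClass.coe_sub,
      Literature.NumberTheory.EllipticCurves.AddSubgroup.torsionBy.coe_smul]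
    apply hinj
    simp only [map_sub, pointsMap_smul]
    exact key
  · -- the moved `p^k`-torsion point comes from `E(K̄)`
    obtain ⟨P₀, hpP₀, hP₀Q⟩ := exists_pointsMapOfEmb_eq_of_nsmul_eq_zero W
      (closureEmb (K := K) (v.adicCompletion K)) (pow_ne_zero k hp.ne_zero) hpQ
    have hmem : P₀ ∈ geomTorsion W ((p ^ k : ℕ) : ℤ) := by
      refine (Submodule.mem_torsionBy_iff _ _).mpr ?_
      change ((p ^ k : ℕ) : ℤ) • P₀ = 0
      rw [natCast_zsmul, hpP₀]
    refine ⟨⟨P₀, hmem⟩, fun h ↦ hτQ ?_⟩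
    have h' := congrArg
      (fun R : geomTorsion W ((p ^ k : ℕ) : ℤ) ↦ pointsMap W (v.adicCompletion K) (R : geomPoints W)) h
    simp only [Literature.NumberTheory.EllipticCurves.AddSubgroup.torsionBy.coe_smul,
      pointsMap_smul] at h'
    rw [← hP₀Q]
    exact h'


/-! ### Lift to the Tate module -/



open Summit.BirchSwinnertonDyer.BirchSwinnertonDyer.Theorems.OneSidedTwistSqueezeX9KatoDivisibilityX9ULedger

omit [NumberField K] in
/-- **Levelwise unipotency lifts to `T_p E`**: if `σ (σ P - P) = σ P - P` on every `E[p^n]`, then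
`(ρ_{E,p}(σ) - 1)² = 0` on the Tate module (componentwise, `TateModule.ext`). [folklore] -/
theorem galoisRepTate_sub_one_mul_self_eq_zero {p : ℕ} [Fact p.Prime] {σ : absoluteGaloisGroup K}
    (hunip : ∀ (n : ℕ) (P : geomTorsion W ((p ^ n : ℕ) : ℤ)), σ • (σ • P - P) = σ • P - P) :
    (W.galoisRepTate p σ - 1) * (W.galoisRepTate p σ - 1) = 0 := by
  apply LinearMap.ext
  intro t
  apply TateModule.ext
  intro n
  have hmem : TateModule.proj p n t ∈ geomTorsion W ((p ^ n : ℕ) : ℤ) :=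
    W.proj_tateModule_mem_geomTorsion p n t
  have h := congrArg Subtype.val (hunip n ⟨TateModule.proj p n t, hmem⟩)
  simp only [AddSubgroupClass.coe_sub,
    Literature.NumberTheory.EllipticCurves.AddSubgroup.torsionBy.coe_smul] at h
  simp only [Module.End.mul_apply, LinearMap.sub_apply, galoisRepTate_apply_apply, Module.End.one_apply,
    map_sub, TateModule.proj_smul_of_distribMulAction, LinearMap.zero_apply, map_zero]
  rw [smul_sub] at h
  rw [h, sub_self]

/-- **Unipotent ⟹ `det = 1`, `tr = 2` on `T_p E`** (rank two over the domain `ℤ_p`: a square-zero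
endomorphism has trace and determinant `0`). [cite: SilvermanAEC2009, Prop. III.7.1(a)] -/
theorem det_trace_galoisRepTate_of_unipotent [W.IsElliptic] {p : ℕ} [Fact p.Prime]
    {σ : absoluteGaloisGroup K}
    (hN : (W.galoisRepTate p σ - 1) * (W.galoisRepTate p σ - 1) = 0) :
    LinearMap.det (W.galoisRepTate p σ) = 1 ∧
      LinearMap.trace ℤ_[p] _ (W.galoisRepTate p σ) = 2 := by
  haveI : Module.Free ℤ_[p] (W.tateModule p) := module_free_tateModule_holds W p
  haveI : Module.Finite ℤ_[p] (W.tateModule p) := module_finite_tateModule_holds W p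
  have h2 : Module.finrank ℤ_[p] (W.tateModule p) = 2 :=
    finrank_tateModule_eq_two_holds W p (Nat.cast_ne_zero.mpr (Fact.out : p.Prime).ne_zero)
  let b := Module.finBasisOfFinrankEq ℤ_[p] (W.tateModule p) h2
  set N : Module.End ℤ_[p] (W.tateModule p) := W.galoisRepTate p σ - 1 with hNdef
  have hρ : W.galoisRepTate p σ = 1 + N := by rw [hNdef, add_sub_cancel]
  set A : Matrix (Fin 2) (Fin 2) ℤ_[p] := LinearMap.toMatrix b b N with hA
  have hAA : A * A = 0 := by
    rw [hA, ← LinearMap.toMatrix_mul, hN, map_zero]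
  obtain ⟨htr, hdet⟩ := trace_det_eq_zero_of_sq_zero A hAA
  have hA1 : LinearMap.toMatrix b b (W.galoisRepTate p σ) = 1 + A := by
    rw [hρ, map_add, LinearMap.toMatrix_one, hA]
  constructor
  · rw [← LinearMap.det_toMatrix b, hA1, det_one_add_fin_two, htr, hdet, add_zero, add_zero]
  · rw [LinearMap.trace_eq_matrix_trace ℤ_[p] b, hA1, Matrix.trace_add, Matrix.trace_one, htr, add_zero,
      Fintype.card_fin]
    norm_num

omit [NumberField K] in
/-- **A moved `p^k`-torsion point is a depth digit**: if `σ` moves some `Q ∈ E[p^k]` then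
`ρ_{E,p}(σ) - 1 ∉ p^k · End(T_p E)` (`T_p E → E[p^k]` is onto and kills `p^k`). [cite: SilvermanAEC2009, III.§7] -/
theorem galoisRepTate_sub_one_ne_pow_smul [W.IsElliptic] {p : ℕ} [Fact p.Prime]
    {σ : absoluteGaloisGroup K} {k : ℕ} (hQ : ∃ Q : geomTorsion W ((p ^ k : ℕ) : ℤ), σ • Q ≠ Q)
    (g : Module.End ℤ_[p] (W.tateModule p)) :
    W.galoisRepTate p σ - 1 ≠ ((p : ℤ_[p]) ^ k) • g := by
  intro h
  obtain ⟨Q, hQ⟩ := hQ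
  obtain ⟨t, ht⟩ := W.proj_surjective_of_isAlgClosed_holds p k (P := (Q : geomPoints W)) Q.2
  apply hQ
  have h1 := congrArg (fun f : Module.End ℤ_[p] (W.tateModule p) ↦ TateModule.proj p k (f t)) h
  simp only [LinearMap.sub_apply, galoisRepTate_apply_apply, Module.End.one_apply, map_sub,
    TateModule.proj_smul_of_distribMulAction, LinearMap.smul_apply, TateModule.proj_smul, ht] at h1
  have hz : (PadicInt.toZModPow k ((p : ℤ_[p]) ^ k)).val = 0 := by
    rw [map_pow, map_natCast, ← Nat.cast_pow, ZMod.natCast_self, ZMod.val_zero]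
  rw [hz, zero_smul, sub_eq_zero] at h1
  exact Subtype.ext h1

/-- **The E-side digits of desc-S71m, from the tree.**  At a multiplicative `v ∤ p` with
`p^k ∤ ord_v(Δ_min)` (`k ≥ 1`) some `τ` of the inertia group `I_v ≤ Γ_K` of the chosen embedding
(`GreenbergSelmer.inertia v`) satisfies `(ρ(τ) - 1)² = 0`, `det ρ(τ) = 1`, `tr ρ(τ) = 2` on `T_p E`, moves
some `Q ∈ E[p^k]`, and `ρ(τ) - 1 ∉ p^k End(T_p E)`.
[cite: SilvermanATAEC1994, V.4–V.5 (Tate curve) and Exercise 5.13(b) (PDF p. 416)]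
[cite: SerreAbelianLadic1968, Ch. IV, A.1.2] [cite: SilvermanAEC2009, Prop. III.7.1(a)] -/
theorem exists_inertia_tateDigits_of_not_pow_dvd [W.IsElliptic]
    (hmult : W.HasMultiplicativeReductionAt v) {p : ℕ} [Fact p.Prime]
    (hpv : (p : 𝓞 K) ∉ v.asIdeal) {k : ℕ} (hk : 1 ≤ k)
    (hndvd : ¬ p ^ k ∣ W.ordMinimalDiscriminant v) :
    ∃ τ ∈ GreenbergSelmer.inertia (K := K) v,
      (W.galoisRepTate p τ - 1) * (W.galoisRepTate p τ - 1) = 0 ∧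
      LinearMap.det (W.galoisRepTate p τ) = 1 ∧
      LinearMap.trace ℤ_[p] _ (W.galoisRepTate p τ) = 2 ∧
      (∃ Q : geomTorsion W ((p ^ k : ℕ) : ℤ), τ • Q ≠ Q) ∧
      ∀ g : Module.End ℤ_[p] (W.tateModule p), W.galoisRepTate p τ - 1 ≠ ((p : ℤ_[p]) ^ k) • g := by
  obtain ⟨τ, hτ, hunip, hQ⟩ :=
    W.exists_absInertia_unipotent_smul_ne_of_not_pow_dvd hmult (Fact.out : p.Prime) hpv hk hndvd
  have hN := W.galoisRepTate_sub_one_mul_self_eq_zero (p := p) hunip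
  refine ⟨resGal (K := K) (v.adicCompletion K) τ, ?_, hN, (W.det_trace_galoisRepTate_of_unipotent hN).1,
    (W.det_trace_galoisRepTate_of_unipotent hN).2, hQ, fun g ↦ W.galoisRepTate_sub_one_ne_pow_smul hQ g⟩
  rw [resGal_eq_absGaloisRestrict]
  exact Subgroup.mem_map.mpr ⟨τ, hτ, rfl⟩

end WeierstrassCurve

/-! ## `m_v ≥ 1` from the image type (Serre 1972 Prop. 15, tree `not_dvd_card_of_…`) -/

namespace WeierstrassCurve

open NumberField IsDedekindDomain
open Literature.NumberTheory.EllipticCurves Literature.NumberTheory.GaloisRepresentations Field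
  IsDedekindDomain.HeightOneSpectrum


/-- **`E[p]` irreducible, `ρ̄_{E,p}` not onto, `v ∤ p` multiplicative ⟹ `p ∣ ord_v(Δ_min)`** (`ρ̄` is unramified at
`v`): otherwise inertia contributes an element of order `p` to `ρ̄(Γ_ℚ)` (unipotent on `E[p]`, moving a `p`-torsion
point — Tate curve), contradicting `p ∤ #ρ̄(Γ_ℚ)` (Serre 1972 Prop. 15 with `det ρ̄ = χ̄_p` onto, tree
`not_dvd_card_of_not_hasSurjectiveModNGaloisRep`).
[cite: Serre1972, §2.4 Prop. 15; §5.4, proof of Prop. 21] [cite: SilvermanATAEC1994, Exercise 5.13(b) (PDF p. 416)] -/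
theorem dvd_ordMinimalDiscriminant_of_not_hasSurjectiveModNGaloisRep (W : WeierstrassCurve ℚ) [W.IsElliptic]
    (p : ℕ) [Fact p.Prime] (hirr : W.HasIrreducibleModPGaloisRep p) (hns : ¬ W.HasSurjectiveModNGaloisRep p)
    {v : HeightOneSpectrum (𝓞 ℚ)} (hmult : W.HasMultiplicativeReductionAt v) (hpv : (p : 𝓞 ℚ) ∉ v.asIdeal) :
    p ∣ W.ordMinimalDiscriminant v := by
  by_contra hnd
  have hnd' : ¬ p ^ 1 ∣ W.ordMinimalDiscriminant v := by rwa [pow_one]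
  obtain ⟨τ, -, hunip, Q, hQ⟩ :=
    W.exists_absInertia_unipotent_smul_ne_of_not_pow_dvd hmult (Fact.out : p.Prime) hpv le_rfl hnd'
  set σ : absoluteGaloisGroup ℚ := resGal (K := ℚ) (v.adicCompletion ℚ) τ with hσ
  -- unipotency and the moved point on `E[p]` proper (`p ^ 1 = p`)
  have hunip1 : ∀ P : geomTorsion W (p : ℤ), σ • (σ • P - P) = σ • P - P := by
    intro P
    have hmem : (P : geomPoints W) ∈ geomTorsion W ((p ^ 1 : ℕ) : ℤ) := by rw [pow_one]; exact P.2
    have h := congrArg Subtype.val (hunip 1 ⟨P, hmem⟩)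
    simp only [AddSubgroupClass.coe_sub,
      Literature.NumberTheory.EllipticCurves.AddSubgroup.torsionBy.coe_smul] at h
    apply Subtype.ext
    simp only [AddSubgroupClass.coe_sub,
      Literature.NumberTheory.EllipticCurves.AddSubgroup.torsionBy.coe_smul]
    exact h
  have hmemQ : (Q : geomPoints W) ∈ geomTorsion W (p : ℤ) := by
    refine (Submodule.mem_torsionBy_iff _ _).mpr ?_
    have h2 := (Submodule.mem_torsionBy_iff _ _).mp Q.2
    simpa only [pow_one] using h2
  set Q₁ : geomTorsion W (p : ℤ) := ⟨Q, hmemQ⟩ with hQ₁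
  have hQ₁ne : σ • Q₁ ≠ Q₁ := by
    intro h
    apply hQ
    apply Subtype.ext
    have h' := congrArg Subtype.val h
    simpa only [Literature.NumberTheory.EllipticCurves.AddSubgroup.torsionBy.coe_smul] using h'
  -- `σ^n P = P + n (σ P − P)` on `E[p]`
  have hiter : ∀ (n : ℕ) (P : geomTorsion W (p : ℤ)), σ ^ n • P = P + n • (σ • P - P) := by
    intro n P
    induction n with
    | zero => rw [pow_zero, one_smul, zero_smul, add_zero]
    | succ n ih =>
      have hns : σ • (n • (σ • P - P)) = n • (σ • P - P) := by
        rw [← DistribMulAction.toAddMonoidHom_apply, map_nsmul, DistribMulAction.toAddMonoidHom_apply,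
          hunip1 P]
      rw [pow_succ', mul_smul, ih, smul_add, hns, succ_nsmul]
      abel
  -- `p • x = 0` on `E[p]`
  have hpz : ∀ x : geomTorsion W (p : ℤ), p • x = 0 := by
    intro x
    apply Subtype.ext
    have h2 : (p : ℤ) • (x : geomPoints W) = 0 := (Submodule.mem_torsionBy_iff _ _).mp x.2
    rw [natCast_zsmul] at h2
    simpa only [AddSubmonoidClass.coe_nsmul, ZeroMemClass.coe_zero] using h2
  -- the element `ρ̄(σ)` has order `p`
  set g : Multiplicative (AddAut (geomTorsion W (p : ℤ))) := galoisRepTorsion W p σ with hg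
  have hg1 : g ≠ 1 := by
    intro h
    apply hQ₁ne
    have h1 := congrArg (fun γ : Multiplicative (AddAut (geomTorsion W (p : ℤ))) ↦ (Multiplicative.toAdd γ) Q₁) h
    simpa only [hg, galoisRepTorsion_apply, toAdd_one, AddAut.zero_apply] using h1
  have hgp : g ^ p = 1 := by
    rw [hg, ← map_pow]
    apply Multiplicative.toAdd.injective
    ext T
    rw [show (Multiplicative.toAdd (galoisRepTorsion W p (σ ^ p))) T = σ ^ p • T from
        galoisRepTorsion_apply W p (σ ^ p) T, hiter p T, hpz, add_zero, toAdd_one, AddAut.zero_apply]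
  have horder : orderOf g = p := orderOf_eq_prime hgp hg1
  -- so `p ∣ #ρ̄(Γ_ℚ)`, contradicting Serre Prop. 15 for the image type
  have hmem : g ∈ (galoisRepTorsion W (p : ℤ)).range := ⟨σ, rfl⟩
  have hdvd : p ∣ Nat.card (galoisRepTorsion W (p : ℤ)).range := by
    have h := orderOf_dvd_natCard (⟨g, hmem⟩ : (galoisRepTorsion W (p : ℤ)).range)
    rwa [Subgroup.orderOf_mk, horder] at h
  obtain ⟨e, Φ, he, -⟩ := exists_frame_galoisRepTorsion_rat W p
  have hnot := not_dvd_card_of_not_hasSurjectiveModNGaloisRep W p Φ e he hirr hns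
  rw [card_map_range_galoisRepTorsion W p Φ] at hnot
  exact hnot hdvd

end WeierstrassCurve
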